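import Summits.AtomisticToContinuum.Crystallization.Theorems.FreeSplittingCertificatesStrictSplittingRuleTorusParamGlue

/-!
# Symbolic (parametrised) term lists: coefficients linear in a finite family of monomial values

A parametrised quadratic form `Q(a,h)(v) = Σ_i c_i(a,h)·ℓ_i(v)·ℓ′_i(v)` whose coefficients are `ℚ`-linear combinations
`c_i(a,h) = Σ_k q_{ik}·t_k(a,h)` of finitely many MONOMIAL VALUES `t : Fin K → ℝ` (products of `a`, `h`, `W′(s_c)`,
`W″(s_c)`, …) is stored as a list of symbolic terms `(σ_i, ℓ_i, ℓ′_i)` with sparse `σ_i : List (Fin K × ℚ)`.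
`collect ts k` extracts the rational term list multiplying `t_k`, and `evalS_eq_sum_collect` is the regrouping identity
`Q(a,h)(v) = Σ_{k ∈ S} t_k(a,h) · evalQR (collect ts k) v` (for any finite key set `S` containing the keys of `ts`) that
feeds `paramForm_ge_of_corners`.  Keys live in any type with decidable equality (the model uses structured monomials).
[folklore]
-/

namespace Summit.AtomisticToContinuum.Crystallization.Theorems.StrictSplittingRuleTorusLMI

open Literature.Computation.Certificates

variable {N : ℕ} {ι : Type*} [DecidableEq ι]

/-- A symbolic coefficient: sparse `ℚ`-linear combination of monomial keys. [folklore] -/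
abbrev SCoef (ι : Type*) := List (ι × ℚ)

/-- A symbolic term `(σ, ℓ, ℓ′)`: coefficient `σ` (linear in the monomial values) times `ℓ(v)·ℓ′(v)`. [folklore] -/
abbrev STerm (N : ℕ) (ι : Type*) := SCoef ι × LinF N × LinF N

/-- Value of a symbolic coefficient at monomial values `t`. [folklore] -/
noncomputable def SCoef.evalR (σ : SCoef ι) (t : ι → ℝ) : ℝ := (σ.map fun p => (p.2 : ℝ) * t p.1).sum

omit [DecidableEq ι] in
/-- `SCoef.evalR`, nil. [folklore] -/
@[simp] theorem SCoef.evalR_nil (t : ι → ℝ) : SCoef.evalR ([] : SCoef ι) t = 0 := rfl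

omit [DecidableEq ι] in
/-- `SCoef.evalR`, cons. [folklore] -/
@[simp] theorem SCoef.evalR_cons (p : ι × ℚ) (σ : SCoef ι) (t : ι → ℝ) :
    SCoef.evalR (p :: σ) t = (p.2 : ℝ) * t p.1 + SCoef.evalR σ t := by
  simp [SCoef.evalR]

/-- The keys of a symbolic term list all lie in `S`. [folklore] -/
def KeysIn (ts : List (STerm N ι)) (S : Finset ι) : Prop := ∀ s ∈ ts, ∀ p ∈ s.1, p.1 ∈ S

/-- Value of a symbolic term list at monomial values `t` and field `v`. [folklore] -/
noncomputable def evalS (ts : List (STerm N ι)) (t : ι → ℝ) (v : Fin N → ℝ) : ℝ :=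
  (ts.map fun s => SCoef.evalR s.1 t * s.2.1.evalR v * s.2.2.evalR v).sum

omit [DecidableEq ι] in
/-- `evalS`, nil. [folklore] -/
@[simp] theorem evalS_nil (t : ι → ℝ) (v : Fin N → ℝ) : evalS ([] : List (STerm N ι)) t v = 0 := rfl

omit [DecidableEq ι] in
/-- `evalS`, cons. [folklore] -/
@[simp] theorem evalS_cons (s : STerm N ι) (ts : List (STerm N ι)) (t : ι → ℝ) (v : Fin N → ℝ) :
    evalS (s :: ts) t v = SCoef.evalR s.1 t * s.2.1.evalR v * s.2.2.evalR v + evalS ts t v := by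
  simp [evalS]

omit [DecidableEq ι] in
/-- `evalS` is additive under concatenation. [folklore] -/
@[simp] theorem evalS_append (ts ts' : List (STerm N ι)) (t : ι → ℝ) (v : Fin N → ℝ) :
    evalS (ts ++ ts') t v = evalS ts t v + evalS ts' t v := by
  induction ts with
  | nil => simp
  | cons s ts ih => simp [ih, add_assoc]

/-- The rational term list multiplying the monomial value `t_k`: one term `(q, ℓ, ℓ′)` for every entry `(k, q)` of every
symbolic coefficient. [folklore] -/
def collect (ts : List (STerm N ι)) (k : ι) : List (Term N) :=
  ts.flatMap fun s => (s.1.filter fun p => p.1 = k).map fun p => (p.2, s.2.1, s.2.2)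

/-- `collect` of a cons. [folklore] -/
theorem collect_cons (s : STerm N ι) (ts : List (STerm N ι)) (k : ι) :
    collect (s :: ts) k = ((s.1.filter fun p => p.1 = k).map fun p => (p.2, s.2.1, s.2.2)) ++ collect ts k := by
  simp [collect]

/-- A symbolic coefficient regrouped by key over any finite `S` containing its keys. [folklore] -/
theorem SCoef.evalR_eq_sum_filter (σ : SCoef ι) (S : Finset ι) (hS : ∀ p ∈ σ, p.1 ∈ S) (t : ι → ℝ) :
    SCoef.evalR σ t = ∑ k ∈ S, ((σ.filter fun p => p.1 = k).map fun p => (p.2 : ℝ)).sum * t k := by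
  induction σ with
  | nil => simp
  | cons p σ ih =>
    rw [SCoef.evalR_cons, ih (fun p' hp' => hS p' (by simp [hp']))]
    have hsplit : ∀ k : ι, (((p :: σ).filter fun p' => p'.1 = k).map fun p' => (p'.2 : ℝ)).sum * t k
        = (if p.1 = k then (p.2 : ℝ) * t k else 0) + ((σ.filter fun p' => p'.1 = k).map fun p' => (p'.2 : ℝ)).sum * t k := by
      intro k
      by_cases hk : p.1 = k
      · simp [hk, add_mul]
      · simp [hk]
    simp only [hsplit, Finset.sum_add_distrib]
    congr 1
    rw [Finset.sum_ite_eq S p.1 (fun k => (p.2 : ℝ) * t k), if_pos (hS p (by simp))]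

/-- One symbolic term regrouped: `σ(t)·ℓℓ′ = Σ_{k∈S} t_k · evalQR [(q,ℓ,ℓ′) : (k,q) ∈ σ]`. [folklore] -/
theorem evalS_single_eq (s : STerm N ι) (S : Finset ι) (hS : ∀ p ∈ s.1, p.1 ∈ S) (t : ι → ℝ) (v : Fin N → ℝ) :
    SCoef.evalR s.1 t * s.2.1.evalR v * s.2.2.evalR v =
      ∑ k ∈ S, t k * evalQR ((s.1.filter fun p => p.1 = k).map fun p => (p.2, s.2.1, s.2.2)) v := by
  rw [SCoef.evalR_eq_sum_filter s.1 S hS, Finset.sum_mul, Finset.sum_mul]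
  refine Finset.sum_congr rfl fun k _ => ?_
  have : ∀ (l : List (ι × ℚ)), evalQR (l.map fun p => (p.2, s.2.1, s.2.2)) v
      = (l.map fun p => (p.2 : ℝ)).sum * s.2.1.evalR v * s.2.2.evalR v := by
    intro l
    induction l with
    | nil => simp
    | cons p l ih => rw [List.map_cons, evalQR_cons, ih, List.map_cons, List.sum_cons]; ring
  rw [this]; ring

/-- **Regrouping identity**: `evalS ts t v = Σ_{k ∈ S} t_k · evalQR (collect ts k) v` for every finite `S` containing
the keys of `ts`. [folklore] -/
theorem evalS_eq_sum_collect (ts : List (STerm N ι)) (S : Finset ι) (hS : KeysIn ts S) (t : ι → ℝ)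
    (v : Fin N → ℝ) : evalS ts t v = ∑ k ∈ S, t k * evalQR (collect ts k) v := by
  induction ts with
  | nil => simp [collect]
  | cons s ts ih =>
    rw [evalS_cons, ih (fun s' hs' => hS s' (by simp [hs'])), evalS_single_eq s S (hS s (by simp)),
      ← Finset.sum_add_distrib]
    refine Finset.sum_congr rfl fun k _ => ?_
    rw [collect_cons, evalQR_append]; ring

/-- **Box certificate for a symbolic term list** (the statement the torus box theorem instantiates), keys in `Fin K`:
if the monomial values `t_k(a,h)` are affinely enclosed on the box, `Pabs k` majorises `|collect ts k|`, and the four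
corner term lists are nonnegative forms, then `E(v) ≤ evalS ts (t(a,h)) v` for every `(a,h)` in the box and every real
field `v`.  (A model with structured monomial keys `ι` re-indexes them by `Fin K` through a key list.) [folklore] -/
theorem evalS_ge_of_corners {K : ℕ} {a₀ h₀ Δ : ℚ} (hΔ : 0 ≤ Δ) (ts : List (STerm N (Fin K)))
    (Pabs : Fin K → List (Term N))
    (hPabs : ∀ k (v : Fin N → ℝ), |evalQR (collect ts k) v| ≤ evalQR (Pabs k) v) (t : Fin K → ℝ → ℝ → ℝ)
    (c₀ c₁ c₂ ρ : Fin K → ℚ) (henc : ∀ k, AffEncl (a₀ : ℝ) h₀ Δ (t k) (c₀ k) (c₁ k) (c₂ k) (ρ k))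
    (E : List (Term N))
    (hcorner : ∀ sa ∈ ({1, -1} : Finset ℚ), ∀ sh ∈ ({1, -1} : Finset ℚ), ∀ v : Fin N → ℝ,
      0 ≤ evalQR (cornerTerms Δ (collect ts) Pabs c₀ c₁ c₂ ρ E sa sh) v)
    {a h : ℝ} (ha : |a - a₀| ≤ Δ) (hh : |h - h₀| ≤ Δ) (v : Fin N → ℝ) :
    evalQR E v ≤ evalS ts (fun k => t k a h) v := by
  rw [evalS_eq_sum_collect ts Finset.univ (fun _ _ _ _ => Finset.mem_univ _)]
  exact paramForm_ge_of_corners hΔ (collect ts) Pabs hPabs t c₀ c₁ c₂ ρ henc E hcorner ha hh v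

end Summit.AtomisticToContinuum.Crystallization.Theorems.StrictSplittingRuleTorusLMI
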